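import Mathlib
import Summits.CriticalPhenomena.CardyFormulaZ2.Theorems.CardyMagicRigidityMagicFormulaTSmearedCentring
import Summits.CriticalPhenomena.CardyFormulaZ2.Theorems.CardyMagicRigidityMagicFormulaTStubBandCentringZ2
import Summits.CriticalPhenomena.CardyFormulaZ2.Theorems.CardyMagicRigidityNestingRigidityUVExpMomentsDilation
import HarnessLib

/-!
# Band centring on both lattices (crux `MagicFormulaT`, line `Sketch` v6, stub `stub_bandCentring`)

Crux `Summit.CriticalPhenomena.CardyFormulaZ2.Theses.CardyMagicRigidity.MagicFormulaT`
(stmt-CriticalPhenomena-4836), line `Sketch` (skeleton v6, the UV split), registered stub S3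
`stub_bandCentring`: **the exact centring of the phase sum over the loops of trace-diameter `< η`,
at every mesh `δ > 0`, on both lattice ensembles `E ∈ latticeEnsembles = {zEns, tEns}`** — for
every admissible neutral density `f` (measurable, `|f| ≤ C`, `f = 0` off `‖z‖ ≤ R`, `∫ f = 0`),
`E[Σ_{u ∈ loops(X_δ ω), diam u < η} ∫_{W(u,·) ≠ 0} f] = 0`.  It removes the drift of the band
statistics in the Hölder estimate "small loops are negligible, uniformly in the mesh".

* `tEns` (`bc_bandCentring_tEns`): c1's unit-lattice centring of the dilated density over the small
  loops (`integral_finsum_nestingPhase_dilate_smallLoops_eq_zero`, `…MagicFormulaTSmearedCentring`)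
  transported to mesh `δ`: the loops of `δ𝕋` are the `δ`-dilates of the loops of `𝕋`
  (`loops_tEns_mul`), diameters scale by `δ` (`bc_diam_range_imageOn_mul`), so the family
  `{diam < η}` at mesh `δ` is the image of the family `{diam < η/δ}` at mesh `1`
  (`bc_sep_diam_lt_image_mul`), interiors dilate and `∫_{δA} f = ∫_A δ² f(δ·)`
  (`setOf_wind_imageOn_mul_ne_zero`, `setIntegral_smul_set_eq`).
* `zEns` (`bc_bandCentring_zEns`, `…MagicFormulaTStubBandCentringZ2`): the family version of
  keystone K3 `smearedCentring_zEns` (the point reflections of `ℤ²` and the duality map are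
  isometries / reversals of the loops, hence preserve every diameter-defined family).

No definition, no cited fact.
-/

noncomputable section

namespace Summit.CriticalPhenomena.CardyFormulaZ2.Cruxes.MagicFormulaT.LineSketch

open MeasureTheory Filter Set
open scoped Real Topology BigOperators Pointwise
open Literature.Probability.RandomPlanarGeometry Literature.Probability.Percolation
  Literature.Probability.LatticeModels
open Summit.CriticalPhenomena.CardyFormulaZ2.Cruxes.NestingRigidity.RingCloudTomography
open Summit.CriticalPhenomena.CardyFormulaZ2.Cruxes.NestingRigidity.PositiveConeWeightDoubling.UVExpMoments
  (range_imageOn_mul loops_tEns_mul)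

/-! ## The `tEns` half: transport of the unit-lattice centring along the dilation -/

/-- Diameters of traces scale under the dilation `z ↦ cz`, `c > 0`:
`diam (c · u) = c · diam u`. -/
theorem bc_diam_range_imageOn_mul {c : ℝ} (hc : 0 < c) (u : UnbasedLoop ℂ) :
    Metric.diam (UnbasedLoop.imageOn (fun z ↦ (c : ℂ) * z) univ u).range =
      c * Metric.diam u.range := by
  rw [range_imageOn_mul, diam_smul₀, Complex.norm_real, Real.norm_of_nonneg hc.le]

/-- Among the `c`-dilates of a loop family (`c > 0`), the loops of diameter `< η` are exactly the
dilates of the loops of the family of diameter `< η / c`. -/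
theorem bc_sep_diam_lt_image_mul {c : ℝ} (hc : 0 < c) (L : Set (UnbasedLoop ℂ)) (η : ℝ) :
    {u ∈ UnbasedLoop.imageOn (fun z ↦ (c : ℂ) * z) univ '' L | Metric.diam u.range < η} =
      UnbasedLoop.imageOn (fun z ↦ (c : ℂ) * z) univ ''
        (L ∩ {u | Metric.diam u.range < η / c}) := by
  ext v
  simp only [mem_setOf_eq, mem_image, mem_inter_iff]
  constructor
  · rintro ⟨⟨u, hu, rfl⟩, hv⟩
    refine ⟨u, ⟨hu, ?_⟩, rfl⟩
    rw [bc_diam_range_imageOn_mul hc] at hv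
    rwa [lt_div_iff₀ hc, mul_comm]
  · rintro ⟨u, ⟨hu, hq⟩, rfl⟩
    refine ⟨⟨u, hu, rfl⟩, ?_⟩
    rw [bc_diam_range_imageOn_mul hc, mul_comm, ← lt_div_iff₀ hc]
    exact hq

/-- **Band centring on site-`𝕋`** (the `tEns` half of stub `stub_bandCentring`): for every
admissible neutral density `f`, every mesh `δ > 0` and every cut-off `η`,
`E_{1/2}[Σ_{u interface loop of δ𝕋, diam u < η} ∫_{W(u,·) ≠ 0} f] = 0` — the small-loop family at
mesh `δ` is the dilate of the family `{diam < η/δ}` of the unit lattice, over which the dilated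
density `δ² f(δ·)` is centred (`integral_finsum_nestingPhase_dilate_smallLoops_eq_zero`). -/
theorem bc_bandCentring_tEns (f : ℂ → ℝ) (R C δ η : ℝ) (hf : Measurable f)
    (hC : ∀ z, |f z| ≤ C) (hR : ∀ z, R < ‖z‖ → f z = 0) (h0 : ∫ z, f z = 0) (hδ : 0 < δ) :
    ∫ ω, (∑ᶠ u ∈ {u ∈ (tEns.X δ ω).loops | Metric.diam u.range < η}, u.nestingPhase f)
      ∂tEns.P = 0 := by
  have hX : ∀ ω : tEns.Ω, tEns.X δ ω = tEns.X (δ * 1) ω := fun ω ↦ by rw [mul_one]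
  have hcongr : ∀ ω : tEns.Ω,
      (∑ᶠ u ∈ {u ∈ (tEns.X δ ω).loops | Metric.diam u.range < η}, u.nestingPhase f) =
      ∑ᶠ u ∈ (siteLoopConfig 1 ω).loops ∩ {u | Metric.diam u.range < η / δ},
        ∫ z in {z : ℂ | u.wind z ≠ 0}, δ ^ 2 * f ((δ : ℂ) * z) := fun ω ↦ by
    rw [hX, loops_tEns_mul δ 1 ω, bc_sep_diam_lt_image_mul hδ,
      finsum_mem_image (imageOn_mul_injective hδ.ne').injOn]
    refine finsum_mem_congr rfl fun u _ ↦ ?_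
    rw [UnbasedLoop.nestingPhase, setOf_wind_imageOn_mul_ne_zero hδ u, setIntegral_smul_set_eq f hδ]
  simp_rw [hcongr]
  exact integral_finsum_nestingPhase_dilate_smallLoops_eq_zero (η / δ) half hf hC hR h0 hδ

/-! ## The stub -/

/-- **Stub S3 `stub_bandCentring` of line `Sketch` (v6), crux `MagicFormulaT` — BAND CENTRING ON
BOTH LATTICES.**  For `E ∈ latticeEnsembles = {zEns, tEns}`, every admissible neutral density `f`
(measurable, `|f| ≤ C`, `f = 0` off `‖z‖ ≤ R`, `∫ f = 0`), every mesh `δ > 0` and every cut-off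
`η`, the expected total phase of the loops of `X_δ` of trace-diameter `< η` vanishes EXACTLY:
`E[Σ_{u ∈ loops(X_δ ω), diam u < η} ∫_{W(u,·) ≠ 0} f] = 0`.  `zEns`: `bc_bandCentring_zEns` (family
version of `smearedCentring_zEns`: point reflections of `ℤ²` + self-duality of `P_{1/2}`, all
isometries / reversals of the loops, preserving diameters); `tEns`: `bc_bandCentring_tEns` (c1's
unit-lattice small-loop centring transported along the dilation `loops_tEns_mul`). -/
theorem stub_bandCentring : ∀ E ∈ latticeEnsembles, ∀ (f : ℂ → ℝ) (R C δ η : ℝ), Measurable f →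
    (∀ z, |f z| ≤ C) → (∀ z, R < ‖z‖ → f z = 0) → ∫ z, f z = 0 → 0 < δ →
    ∫ ω, (∑ᶠ u ∈ {u ∈ (E.X δ ω).loops | Metric.diam u.range < η}, u.nestingPhase f) ∂E.P = 0 := by
  intro E hE f R C δ η hf hC hR h0 hδ
  simp only [latticeEnsembles, Set.mem_insert_iff, Set.mem_singleton_iff] at hE
  rcases hE with rfl | rfl
  · exact bc_bandCentring_zEns f R C δ η hf hC hR h0 hδ
  · exact bc_bandCentring_tEns f R C δ η hf hC hR h0 hδ

end Summit.CriticalPhenomena.CardyFormulaZ2.Cruxes.MagicFormulaT.LineSketch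

end
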